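import Summits.NavierStokesRegularity.NavierStokesRegularity.Theorems.PerpetualPumpAveragedTypeIBlowupLinearComparison

/-!
# Crux `PerpetualPump.AveragedTypeIBlowup` (stmt-NavierStokesRegularity-1835), line `Sketch`:
# tools for the stub `slavedLadder` — one-step max principles and the continuous induction

This is the first of three files proving the registered stub `stub_slavedLadder` of the line
skeleton `Cruxes/AveragedTypeIBlowup/Lines/Sketch.lean` (G10, Mathlib-only): the ladder of damped
carriers/bonds two or more scales above the front of the cascade stays in a prescribed box. The
proof is a continuous induction ("bootstrap") in the time `σ`: if the box holds on `[0, S]`, then on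
a short window `[S, t]` every excess over the box is bounded by a constant times `(t - S)` times
the maximal excess on the window, so for `t - S` small the maximal excess vanishes. This file
provides the level-independent ingredients.

* `slavedLadder_mode_step` — a damped mode `|z' + R z| ≤ R (B' + D)` on `(S, t)` with
  `|z(S)| ≤ B`, `B' ≤ B` satisfies `|z(σ)| ≤ B + D R (σ - S)` (from the landed damped comparison
  `linearComparison_damped` and the convexity bound `1 - e^{-v} ≤ v`).
* `slavedLadder_majorant_step` — a Duhamel majorant
  `m₀ e^{-R σ} + k ∫₀^σ e^{-R (σ - u)} h(u) du` with `h ≤ c` on `[0, S]`, `h ≤ c + D` on `[S, σ]`,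
  `k c ≤ R M`, `m₀ ≤ M` is at most `M + k D (σ - S)` (exact exponential integrals, splitting the
  integral at `S`).
* `slavedLadder_forcing_x`, `slavedLadder_forcing_y` — the polynomial forcing brackets of the
  carrier and bond equations grow at most linearly in the enlargement `ν ∈ [0, 1]` of the box.
* `slavedLadder_induction`, `slavedLadder_local_small` — the real-variable continuous induction on
  `[0, σ₁]` (Mathlib's `IsClosed.Icc_subset_of_forall_mem_nhdsGT_of_Icc_subset`) and the a priori
  smallness window given by continuity.
* `slavedLadder_collect`, `slavedLadder_extract` — bookkeeping between the four box inequalities of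
  a level and the nonnegative excess `max (|x| - X) 0 + max (|y| - Y) 0 + max (mx - MX) 0 +
  max (my - MY) 0`.

## References

Standard ODE comparison / bootstrap arguments (folklore), organised as in T. Tao, *Finite time
blowup for an averaged three-dimensional Navier–Stokes equation*, J. Amer. Math. Soc. 29 (2016),
§5–6.
-/

noncomputable section

-- the summit namespace `…NavierStokesRegularity.NavierStokesRegularity…` is the tree convention
set_option linter.dupNamespace false

open MeasureTheory Set Filter Topology

namespace Summit.NavierStokesRegularity.NavierStokesRegularity.Theorems.PerpetualPumpAveragedTypeIBlowup

/-- **Exponential kernel integral.** `R ∫ₐᵇ e^{-R (c - u)} du = e^{-R (c - b)} - e^{-R (c - a)}`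
(fundamental theorem of calculus). [folklore] -/
theorem slavedLadder_integral_exp (R c a b : ℝ) :
    R * ∫ u in a..b, Real.exp (-(R * (c - u))) =
      Real.exp (-(R * (c - b))) - Real.exp (-(R * (c - a))) := by
  have hderiv : ∀ u : ℝ, HasDerivAt (fun u => Real.exp (-(R * (c - u))))
      (Real.exp (-(R * (c - u))) * (-(R * (0 - 1)))) u := fun u =>
    (((hasDerivAt_const u c).sub (hasDerivAt_id' u)).const_mul R).neg.exp
  have hcont : Continuous fun u : ℝ => Real.exp (-(R * (c - u))) * (-(R * (0 - 1))) := by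
    fun_prop
  have key := intervalIntegral.integral_eq_sub_of_hasDerivAt (fun u _ => hderiv u)
    (hcont.intervalIntegrable a b)
  have hfun : (fun u => Real.exp (-(R * (c - u))) * (-(R * (0 - 1)))) =
      fun u => R * Real.exp (-(R * (c - u))) := by
    funext u
    ring
  rw [hfun, intervalIntegral.integral_const_mul] at key
  rw [key]

/-- **One step of the max principle for a damped mode.** If `z` is continuous on `[S, t]`,
`|z' + R z| ≤ R (B' + D)` at interior points (`R ≥ 0`, `D ≥ 0`), `|z(S)| ≤ B` and `B' ≤ B`, then
`|z(σ)| ≤ B + D R (σ - S)` on `[S, t]`: by the damped comparison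
`|z(σ)| ≤ |z(S)| e^{-R(σ-S)} + (B' + D)(1 - e^{-R(σ-S)}) ≤ B + D (1 - e^{-R(σ-S)})`. [folklore] -/
theorem slavedLadder_mode_step {z : ℝ → ℝ} {R B B' D S t : ℝ} (hSt : S ≤ t) (hR : 0 ≤ R)
    (hz : ContinuousOn z (Icc S t))
    (hd : ∀ σ ∈ Ioo S t, ∃ z' : ℝ, HasDerivAt z z' σ ∧ |z' + R * z σ| ≤ R * (B' + D))
    (hB : |z S| ≤ B) (hB' : B' ≤ B) (hD : 0 ≤ D) :
    ∀ σ ∈ Icc S t, |z σ| ≤ B + D * (R * (σ - S)) := by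
  intro σ hσ
  have h := linearComparison_damped hSt hz hd hσ
  have hv : 0 ≤ R * (σ - S) := mul_nonneg hR (sub_nonneg.2 hσ.1)
  have he0 : 0 ≤ Real.exp (-(R * (σ - S))) := (Real.exp_pos _).le
  have he1 : Real.exp (-(R * (σ - S))) ≤ 1 := Real.exp_le_one_iff.2 (by linarith)
  have he2 : 1 - Real.exp (-(R * (σ - S))) ≤ R * (σ - S) := by
    linarith [Real.add_one_le_exp (-(R * (σ - S)))]
  have h1 : |z S| * Real.exp (-(R * (σ - S))) ≤ B * Real.exp (-(R * (σ - S))) :=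
    mul_le_mul_of_nonneg_right hB he0
  have h2 : (B' + D) * (1 - Real.exp (-(R * (σ - S)))) ≤
      (B + D) * (1 - Real.exp (-(R * (σ - S)))) :=
    mul_le_mul_of_nonneg_right (by linarith) (by linarith)
  have h3 : D * (1 - Real.exp (-(R * (σ - S)))) ≤ D * (R * (σ - S)) :=
    mul_le_mul_of_nonneg_left he2 hD
  have hB0 : 0 ≤ B := (abs_nonneg _).trans hB
  nlinarith

/-- **One step for a Duhamel majorant.** Let `h` be continuous on `[0, σ]` with `h ≤ c` on
`[0, S]` and `h ≤ c + D` on `[S, σ]` (`0 ≤ S ≤ σ`, `D ≥ 0`), and let `R > 0`, `k ≥ 0` with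
`k c ≤ R M` and `m₀ ≤ M`. Then
`m₀ e^{-R σ} + k ∫₀^σ e^{-R (σ - u)} h(u) du ≤ M + k D (σ - S)`: splitting the integral at `S` and
integrating the exponential kernel exactly gives the bound
`M e^{-Rσ} + M (1 - e^{-Rσ}) + (k D / R)(1 - e^{-R(σ-S)})`. [folklore] -/
theorem slavedLadder_majorant_step {h : ℝ → ℝ} {R k c m0 M D S σ : ℝ} (hR : 0 < R) (hk : 0 ≤ k)
    (hS : 0 ≤ S) (hSσ : S ≤ σ) (hh : ContinuousOn h (Icc 0 σ))
    (h1 : ∀ u ∈ Icc 0 S, h u ≤ c) (h2 : ∀ u ∈ Icc S σ, h u ≤ c + D) (hD : 0 ≤ D)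
    (hc : k * c ≤ R * M) (hm0M : m0 ≤ M) :
    m0 * Real.exp (-(R * σ)) + k * ∫ u in (0 : ℝ)..σ, Real.exp (-(R * (σ - u))) * h u ≤
      M + k * D * (σ - S) := by
  have hEc : Continuous fun u : ℝ => Real.exp (-(R * (σ - u))) := by fun_prop
  have hF : ContinuousOn (fun u => Real.exp (-(R * (σ - u))) * h u) (Icc 0 σ) :=
    hEc.continuousOn.mul hh
  have hF1 : IntervalIntegrable (fun u => Real.exp (-(R * (σ - u))) * h u) volume 0 S :=
    (hF.mono (Icc_subset_Icc_right hSσ)).intervalIntegrable_of_Icc hS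
  have hF2 : IntervalIntegrable (fun u => Real.exp (-(R * (σ - u))) * h u) volume S σ :=
    (hF.mono (Icc_subset_Icc_left hS)).intervalIntegrable_of_Icc hSσ
  have hG1 : IntervalIntegrable (fun u => Real.exp (-(R * (σ - u))) * c) volume 0 S :=
    (hEc.mul continuous_const).intervalIntegrable 0 S
  have hG2 : IntervalIntegrable (fun u => Real.exp (-(R * (σ - u))) * (c + D)) volume S σ :=
    (hEc.mul continuous_const).intervalIntegrable S σ
  have hsplit := intervalIntegral.integral_add_adjacent_intervals hF1 hF2
  have hI1 : ∫ u in (0 : ℝ)..S, Real.exp (-(R * (σ - u))) * h u ≤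
      ∫ u in (0 : ℝ)..S, Real.exp (-(R * (σ - u))) * c :=
    intervalIntegral.integral_mono_on hS hF1 hG1 fun u hu =>
      mul_le_mul_of_nonneg_left (h1 u hu) (Real.exp_pos _).le
  have hI2 : ∫ u in S..σ, Real.exp (-(R * (σ - u))) * h u ≤
      ∫ u in S..σ, Real.exp (-(R * (σ - u))) * (c + D) :=
    intervalIntegral.integral_mono_on hSσ hF2 hG2 fun u hu =>
      mul_le_mul_of_nonneg_left (h2 u hu) (Real.exp_pos _).le
  rw [intervalIntegral.integral_mul_const] at hI1 hI2
  have hJ1 := slavedLadder_integral_exp R σ 0 S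
  have hJ2 := slavedLadder_integral_exp R σ S σ
  rw [sub_self, mul_zero, neg_zero, Real.exp_zero] at hJ2
  rw [sub_zero] at hJ1
  have he2 : 1 - Real.exp (-(R * (σ - S))) ≤ R * (σ - S) := by
    linarith [Real.add_one_le_exp (-(R * (σ - S)))]
  have hE0 : Real.exp (-(R * σ)) ≤ 1 := Real.exp_le_one_iff.2 (by nlinarith)
  have hE0' : 0 ≤ Real.exp (-(R * σ)) := (Real.exp_pos _).le
  set J1 := ∫ u in (0 : ℝ)..S, Real.exp (-(R * (σ - u))) with hJ1def
  set J2 := ∫ u in S..σ, Real.exp (-(R * (σ - u))) with hJ2def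
  set ES := Real.exp (-(R * (σ - S))) with hES
  set E0 := Real.exp (-(R * σ)) with hE0def
  have key : R * (k * (J1 * c + J2 * (c + D))) ≤ R * (M * (1 - E0) + k * D * (σ - S)) := by
    have e1 : R * (k * (J1 * c + J2 * (c + D))) =
        k * c * (R * J1 + R * J2) + k * D * (R * J2) := by ring
    rw [e1, hJ1, hJ2]
    have a1 : k * c * (ES - E0 + (1 - ES)) ≤ R * M * (1 - E0) := by
      rw [show ES - E0 + (1 - ES) = 1 - E0 by ring]
      exact mul_le_mul_of_nonneg_right hc (by linarith)
    have a2 : k * D * (1 - ES) ≤ k * D * (R * (σ - S)) :=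
      mul_le_mul_of_nonneg_left he2 (mul_nonneg hk hD)
    nlinarith
  have key' : k * (J1 * c + J2 * (c + D)) ≤ M * (1 - E0) + k * D * (σ - S) :=
    le_of_mul_le_mul_left key hR
  have hm : m0 * E0 ≤ M * E0 := mul_le_mul_of_nonneg_right hm0M hE0'
  have hsum : k * ∫ u in (0 : ℝ)..σ, Real.exp (-(R * (σ - u))) * h u ≤
      k * (J1 * c + J2 * (c + D)) := by
    rw [← hsplit]
    exact mul_le_mul_of_nonneg_left (add_le_add hI1 hI2) hk
  linarith

/-- Squares are monotone under absolute-value bounds: `|b| ≤ B → b² ≤ B²`. [folklore] -/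
theorem slavedLadder_sq_le {b B : ℝ} (hb : |b| ≤ B) : b ^ 2 ≤ B ^ 2 := by
  have := pow_le_pow_left₀ (abs_nonneg b) hb 2
  rwa [sq_abs] at this

/-- **Carrier forcing bracket under an enlarged box.** If `|a| ≤ A + ν`, `|b| ≤ B + ν`,
`|bm| ≤ Bm + ν` with `0 ≤ ν ≤ 1`, `q ≥ 1`, `εb, Bm ≥ 0`, then
`|bm²/q³ - b² - εb a b| ≤ Bm²/q³ + B² + εb A B + ν (2Bm + 2B + 2 + εb (A + B + 1))`
(the bracket grows at most linearly in the enlargement). [folklore] -/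
theorem slavedLadder_forcing_x {a b bm A B Bm ν q εb : ℝ} (hq : 1 ≤ q) (hεb : 0 ≤ εb)
    (hν0 : 0 ≤ ν) (hν1 : ν ≤ 1) (hBm : 0 ≤ Bm)
    (ha : |a| ≤ A + ν) (hb : |b| ≤ B + ν) (hbm : |bm| ≤ Bm + ν) :
    |bm ^ 2 / q ^ 3 - b ^ 2 - εb * a * b| ≤
      Bm ^ 2 / q ^ 3 + B ^ 2 + εb * A * B + ν * (2 * Bm + 2 * B + 2 + εb * (A + B + 1)) := by
  have hq3 : 1 ≤ q ^ 3 := one_le_pow₀ hq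
  have hq3pos : 0 < q ^ 3 := by positivity
  have hT : |εb * a * b| ≤ εb * ((A + ν) * (B + ν)) := by
    rw [abs_mul, abs_mul, abs_of_nonneg hεb, mul_assoc]
    exact mul_le_mul_of_nonneg_left
      (mul_le_mul ha hb (abs_nonneg _) ((abs_nonneg a).trans ha)) hεb
  have hP : bm ^ 2 / q ^ 3 ≤ (Bm + ν) ^ 2 / q ^ 3 :=
    div_le_div_of_nonneg_right (slavedLadder_sq_le hbm) hq3pos.le
  have hQ : b ^ 2 ≤ (B + ν) ^ 2 := slavedLadder_sq_le hb
  have hP0 : 0 ≤ bm ^ 2 / q ^ 3 := by positivity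
  have hνν : ν * ν ≤ ν := mul_le_of_le_one_right hν0 hν1
  have hdiv : ν * (2 * Bm + ν) / q ^ 3 ≤ ν * (2 * Bm + ν) :=
    div_le_self (mul_nonneg hν0 (by linarith)) hq3
  have hexp : (Bm + ν) ^ 2 / q ^ 3 = Bm ^ 2 / q ^ 3 + ν * (2 * Bm + ν) / q ^ 3 := by
    rw [← add_div]
    ring
  have step1 : |bm ^ 2 / q ^ 3 - b ^ 2 - εb * a * b| ≤ bm ^ 2 / q ^ 3 + b ^ 2 + |εb * a * b| := by
    rw [abs_le]
    constructor
    · nlinarith [le_abs_self (εb * a * b), sq_nonneg b]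
    · nlinarith [neg_abs_le (εb * a * b), sq_nonneg b]
  have step3 : (Bm + ν) ^ 2 / q ^ 3 + (B + ν) ^ 2 + εb * ((A + ν) * (B + ν)) ≤
      Bm ^ 2 / q ^ 3 + B ^ 2 + εb * A * B + ν * (2 * Bm + 2 * B + 2 + εb * (A + B + 1)) := by
    rw [hexp]
    nlinarith [mul_nonneg hεb (sub_nonneg.2 hνν)]
  linarith

/-- **Bond forcing bracket under an enlarged box.** If `|a| ≤ A + ν`, `|a'| ≤ Ap + ν`,
`|b| ≤ B + ν` with `0 ≤ ν ≤ 1`, `q ≥ 1`, `εb, Ap, B ≥ 0`, then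
`|b (a - a'/q) + εb a²| ≤ B (A + Ap/q) + εb A² + ν (2B + A + Ap + 2 + εb (2A + 1))`.
[folklore] -/
theorem slavedLadder_forcing_y {a a' b A Ap B ν q εb : ℝ} (hq : 1 ≤ q) (hεb : 0 ≤ εb)
    (hν0 : 0 ≤ ν) (hν1 : ν ≤ 1) (hAp : 0 ≤ Ap) (hB : 0 ≤ B)
    (ha : |a| ≤ A + ν) (ha' : |a'| ≤ Ap + ν) (hb : |b| ≤ B + ν) :
    |b * (a - a' / q) + εb * a ^ 2| ≤
      B * (A + Ap / q) + εb * A ^ 2 + ν * (2 * B + A + Ap + 2 + εb * (2 * A + 1)) := by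
  have hq0 : 0 < q := by linarith
  have hA0 : 0 ≤ A + ν := (abs_nonneg a).trans ha
  have h1 : |a - a' / q| ≤ (A + ν) + (Ap + ν) / q := by
    refine (abs_sub _ _).trans (add_le_add ha ?_)
    rw [abs_div, abs_of_pos hq0]
    exact div_le_div_of_nonneg_right ha' hq0.le
  have h2 : |b * (a - a' / q)| ≤ (B + ν) * ((A + ν) + (Ap + ν) / q) := by
    rw [abs_mul]
    exact mul_le_mul hb h1 (abs_nonneg _) (by linarith)
  have h3 : |εb * a ^ 2| ≤ εb * (A + ν) ^ 2 := by
    rw [abs_mul, abs_of_nonneg hεb, abs_of_nonneg (sq_nonneg a)]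
    exact mul_le_mul_of_nonneg_left (slavedLadder_sq_le ha) hεb
  have hνν : ν * ν ≤ ν := mul_le_of_le_one_right hν0 hν1
  have d1 : B * ν / q ≤ B * ν := div_le_self (mul_nonneg hB hν0) hq
  have d2 : ν * Ap / q ≤ ν * Ap := div_le_self (mul_nonneg hν0 hAp) hq
  have d3 : ν * ν / q ≤ ν * ν := div_le_self (mul_nonneg hν0 hν0) hq
  have step3 : (B + ν) * ((A + ν) + (Ap + ν) / q) + εb * (A + ν) ^ 2 ≤
      B * (A + Ap / q) + εb * A ^ 2 + ν * (2 * B + A + Ap + 2 + εb * (2 * A + 1)) := by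
    have e : (B + ν) * ((A + ν) + (Ap + ν) / q) = B * A + B * ν + B * Ap / q + B * ν / q +
        ν * A + ν * ν + ν * Ap / q + ν * ν / q := by ring
    have e2 : B * (A + Ap / q) = B * A + B * Ap / q := by ring
    rw [e, e2]
    nlinarith [mul_nonneg hεb (sub_nonneg.2 hνν)]
  calc |b * (a - a' / q) + εb * a ^ 2| ≤ |b * (a - a' / q)| + |εb * a ^ 2| := abs_add_le _ _
    _ ≤ _ := by linarith

/-- **Continuous induction on `[0, σ₁]`.** If `φ` is continuous on `[0, σ₁]`, `φ 0 ≤ 0`, and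
whenever `φ ≤ 0` on `[0, S]` (`0 ≤ S < σ₁`) there is `t ∈ (S, σ₁]` with `φ ≤ 0` on `[S, t]`, then
`φ ≤ 0` on `[0, σ₁]` (Mathlib's `IsClosed.Icc_subset_of_forall_mem_nhdsGT_of_Icc_subset` for the
closed set `{φ ≤ 0}`). [folklore] -/
theorem slavedLadder_induction {φ : ℝ → ℝ} {σ₁ : ℝ} (hφc : ContinuousOn φ (Icc 0 σ₁))
    (hφ0 : φ 0 ≤ 0)
    (step : ∀ S ∈ Ico 0 σ₁, (∀ u ∈ Icc 0 S, φ u ≤ 0) →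
      ∃ t ∈ Ioc S σ₁, ∀ u ∈ Icc S t, φ u ≤ 0) :
    ∀ σ ∈ Icc 0 σ₁, φ σ ≤ 0 := by
  have hs : IsClosed ({σ | φ σ ≤ 0} ∩ Icc 0 σ₁) := by
    rw [inter_comm]
    exact hφc.preimage_isClosed_of_isClosed isClosed_Icc isClosed_Iic
  intro σ hσ
  refine hs.Icc_subset_of_forall_mem_nhdsGT_of_Icc_subset (s := {σ | φ σ ≤ 0}) hφ0 ?_ hσ
  intro S hS hsub
  obtain ⟨t, ht, hφt⟩ := step S hS fun u hu => hsub hu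
  exact mem_of_superset (Ioo_mem_nhdsGT ht.1) fun u hu => hφt u ⟨hu.1.le, hu.2.le⟩

/-- **A priori smallness window.** If `φ` is continuous on `[0, σ₁]` and `φ S ≤ 0` at some
`S ∈ [0, σ₁)`, then for every `δ₀ > 0` there is `t ∈ (S, σ₁]` with `t ≤ S + δ₀` and `φ ≤ 1` on
`[S, t]`. [folklore] -/
theorem slavedLadder_local_small {φ : ℝ → ℝ} {S σ₁ δ₀ : ℝ} (hS : S ∈ Ico 0 σ₁) (hδ : 0 < δ₀)
    (hφc : ContinuousOn φ (Icc 0 σ₁)) (hφS : φ S ≤ 0) :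
    ∃ t ∈ Ioc S σ₁, t ≤ S + δ₀ ∧ ∀ u ∈ Icc S t, φ u ≤ 1 := by
  have hc : ContinuousWithinAt φ (Icc 0 σ₁) S := hφc S ⟨hS.1, hS.2.le⟩
  obtain ⟨δ, hδpos, hδ'⟩ := Metric.continuousWithinAt_iff.1 hc 1 one_pos
  set d := min (σ₁ - S) (min δ δ₀) with hd
  have hd0 : 0 < d := lt_min (by linarith [hS.2]) (lt_min hδpos hδ)
  have hd1 : d ≤ σ₁ - S := min_le_left _ _
  have hd2 : d ≤ δ := (min_le_right _ _).trans (min_le_left _ _)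
  have hd3 : d ≤ δ₀ := (min_le_right _ _).trans (min_le_right _ _)
  refine ⟨S + d / 2, ⟨by linarith, by linarith⟩, by linarith, fun u hu => ?_⟩
  have hu' : u ∈ Icc 0 σ₁ := ⟨hS.1.trans hu.1, by linarith [hu.2]⟩
  have hdist : dist u S < δ := by
    rw [Real.dist_eq, abs_of_nonneg (by linarith [hu.1])]
    linarith [hu.2]
  have := hδ' hu' hdist
  rw [Real.dist_eq] at this
  linarith [(abs_lt.1 this).2]

/-- **From component bounds to the excess.** If the four quantities of a level exceed their box
by at most `β ≥ 0`, the excess `max (|a| - A) 0 + max (|b| - B) 0 + max (c - C) 0 + max (d - D) 0`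
is at most `4β`. [folklore] -/
theorem slavedLadder_collect {a b c d A B C D β : ℝ} (hβ : 0 ≤ β) (ha : |a| ≤ A + β)
    (hb : |b| ≤ B + β) (hc : c ≤ C + β) (hd : d ≤ D + β) :
    max (|a| - A) 0 + max (|b| - B) 0 + max (c - C) 0 + max (d - D) 0 ≤ 4 * β := by
  have h1 : max (|a| - A) 0 ≤ β := max_le (by linarith) hβ
  have h2 : max (|b| - B) 0 ≤ β := max_le (by linarith) hβ
  have h3 : max (c - C) 0 ≤ β := max_le (by linarith) hβ
  have h4 : max (d - D) 0 ≤ β := max_le (by linarith) hβ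
  linarith

/-- **From the excess to component bounds.** If the excess
`max (|a| - A) 0 + max (|b| - B) 0 + max (c - C) 0 + max (d - D) 0` is at most `ν`, each of the
four quantities exceeds its box by at most `ν`. [folklore] -/
theorem slavedLadder_extract {a b c d A B C D ν : ℝ}
    (h : max (|a| - A) 0 + max (|b| - B) 0 + max (c - C) 0 + max (d - D) 0 ≤ ν) :
    |a| ≤ A + ν ∧ |b| ≤ B + ν ∧ c ≤ C + ν ∧ d ≤ D + ν := by
  have h1 := le_max_left (|a| - A) 0
  have h1' := le_max_right (|a| - A) 0
  have h2 := le_max_left (|b| - B) 0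
  have h2' := le_max_right (|b| - B) 0
  have h3 := le_max_left (c - C) 0
  have h3' := le_max_right (c - C) 0
  have h4 := le_max_left (d - D) 0
  have h4' := le_max_right (d - D) 0
  exact ⟨by linarith, by linarith, by linarith, by linarith⟩

/-- **Registered stub `stub_slavedLadderTools`** (tools for the stub `slavedLadder`, line `Sketch`
of crux `PerpetualPump.AveragedTypeIBlowup`, stmt-NavierStokesRegularity-1835): the one-step max
principle for a damped mode (`slavedLadder_mode_step`) and the one-step bound for a Duhamel
majorant (`slavedLadder_majorant_step`). [folklore] -/
theorem stub_slavedLadderTools :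
    (∀ (z : ℝ → ℝ) (R B B' D S t : ℝ), S ≤ t → 0 ≤ R → ContinuousOn z (Icc S t) →
      (∀ σ ∈ Ioo S t, ∃ z' : ℝ, HasDerivAt z z' σ ∧ |z' + R * z σ| ≤ R * (B' + D)) →
      |z S| ≤ B → B' ≤ B → 0 ≤ D → ∀ σ ∈ Icc S t, |z σ| ≤ B + D * (R * (σ - S))) ∧
    (∀ (h : ℝ → ℝ) (R k c m0 M D S σ : ℝ), 0 < R → 0 ≤ k → 0 ≤ S → S ≤ σ →
      ContinuousOn h (Icc 0 σ) → (∀ u ∈ Icc 0 S, h u ≤ c) → (∀ u ∈ Icc S σ, h u ≤ c + D) →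
      0 ≤ D → k * c ≤ R * M → m0 ≤ M →
      m0 * Real.exp (-(R * σ)) + k * ∫ u in (0 : ℝ)..σ, Real.exp (-(R * (σ - u))) * h u ≤
        M + k * D * (σ - S)) :=
  ⟨fun _ _ _ _ _ _ _ hSt hR hz hd hB hB' hD => slavedLadder_mode_step hSt hR hz hd hB hB' hD,
    fun _ _ _ _ _ _ _ _ _ hR hk hS hSσ hh h1 h2 hD hc hm =>
      slavedLadder_majorant_step hR hk hS hSσ hh h1 h2 hD hc hm⟩

end Summit.NavierStokesRegularity.NavierStokesRegularity.Theorems.PerpetualPumpAveragedTypeIBlowup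

end
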